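import Literature.Probability.Percolation.PlanarDuality
import Literature.Probability.LatticeModels.StarCrossing
import HarnessLib

/-!
# Winding numbers of `∗`-walks and a discrete Jordan lemma for semicircuit pairs

Topic `Probability/Percolation`. `PlanarDuality.lean` develops winding numbers of LATTICE walks of
`ℤ²` around dual vertices. Georgii–Higuchi 2000 use, at two places, that a closed `∗`-curve
surrounding a region cannot be left by a lattice path without meeting it: in the pinning lemma
(Lemma 5.2: "`x` is surrounded by a `+∗`semicircuit `σ` … which belongs to `I⁺∗`"), and in
Lemma 5.5 ("if `A_{x,y} ∩ B_{x,y}` occurs then `Δ` is surrounded by a `≤∗`circuit"). We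
provide the corresponding tool for `∗`-WALKS and LATTICE escape paths:

* `starWinding p u` — the signed number of steps of the `∗`-walk `p` between the rows `u₂` and
  `u₂ + 1` whose row-`u₂` endpoint lies in a column `≥ u₁ + 1` (the winding number of `p` around
  the lattice point `u`, rays perturbed upwards);
* `starWinding_eq_of_latticeWalk` — constancy as the base point moves along a lattice walk
  avoiding the vertices of `p` (Kesten 1982, §2.2 type argument);
* vanishing far away (`starWinding_eq_zero_of_*`);
* **`exists_mem_support_of_semicircuits`** — the "eye lemma": if `α` is a `∗`-walk in the closed
  upper half-plane and `α'` one in the closed lower half-plane, both from `(a, 0)` to `(b, 0)`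
  and both avoiding the window `D = [c₁, c₂] × [-m, m]` with `a < c₁ ≤ c₂ < b`, then every
  lattice walk from a site of `D` to a site outside a box containing `α, α'` meets `α` or `α'`.

## References

* H. Kesten, *Percolation theory for mathematicians*, Birkhäuser 1982, §2.2 [Kesten1982].
* H.-O. Georgii, Y. Higuchi, J. Math. Phys. 41 (2000), proofs of Lemma 5.2 and Lemma 5.5
  [GeorgiiHiguchi2000].
-/

noncomputable section

open SimpleGraph
open Literature.Probability.LatticeModels (Site zdGraph zdStarGraph zdGraph_adj_iff zdStarGraph_adj box mem_box)

namespace Literature.Probability.Percolation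

/-! ### The winding number of a `∗`-walk -/

/-- Indicator of a step `x → y` going up from row `u₂` to row `u₂ + 1` whose lower endpoint lies
in a column `≥ u₁ + 1`. [folklore] -/
def starUpStep (u x y : Site 2) : ℤ :=
  if y 1 = x 1 + 1 ∧ x 1 = u 1 ∧ u 0 + 1 ≤ x 0 then 1 else 0

/-- Signed step count: `+1` for such an up-step, `-1` for the reversed down-step. [folklore] -/
def starStepWinding (u x y : Site 2) : ℤ := starUpStep u x y - starUpStep u y x

/-- Antisymmetry. [folklore] -/
theorem starStepWinding_antisymm (u x y : Site 2) : starStepWinding u y x = -starStepWinding u x y := by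
  unfold starStepWinding; ring

/-- The winding number of the `∗`-walk `p` around the lattice point `u` (crossings of the
horizontal ray from `u` to the right, perturbed upwards). [folklore] -/
def starWinding {G : SimpleGraph (Site 2)} {a b : Site 2} (p : G.Walk a b) (u : Site 2) : ℤ :=
  (p.darts.map fun d => starStepWinding u d.fst d.snd).sum

section Basic

variable {G : SimpleGraph (Site 2)}

/-- Winding of the trivial walk. [folklore] -/
@[simp] theorem starWinding_nil (a u : Site 2) : starWinding (Walk.nil : G.Walk a a) u = 0 := rfl

/-- Winding of a walk with a first step. [folklore] -/
@[simp] theorem starWinding_cons {a b c : Site 2} (h : G.Adj a b) (p : G.Walk b c) (u : Site 2) :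
    starWinding (Walk.cons h p) u = starStepWinding u a b + starWinding p u := by
  simp [starWinding]

/-- Additivity. [folklore] -/
@[simp] theorem starWinding_append {a b c : Site 2} (p : G.Walk a b) (q : G.Walk b c) (u : Site 2) :
    starWinding (p.append q) u = starWinding p u + starWinding q u := by
  simp [starWinding, Walk.darts_append]

/-- Reversal negates the winding. [folklore] -/
@[simp] theorem starWinding_reverse {a b : Site 2} (p : G.Walk a b) (u : Site 2) :
    starWinding p.reverse u = -starWinding p u := by
  induction p with
  | nil => simp
  | cons h p ih =>
    simp only [Walk.reverse_cons, starWinding_append, ih, starWinding_cons, starWinding_nil, add_zero]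
    rw [starStepWinding_antisymm]; ring

/-- **Telescoping**: if every step of `p` changes the quantity `g` exactly by its step winding,
the winding is `g b - g a`. [folklore] -/
theorem starWinding_eq_of_telescope {a b : Site 2} (p : G.Walk a b) (u : Site 2) (g : Site 2 → ℤ)
    (h : ∀ d ∈ p.darts, starStepWinding u d.fst d.snd = g d.snd - g d.fst) :
    starWinding p u = g b - g a := by
  induction p with
  | nil => simp
  | cons hadj p ih =>
    rename_i x y z
    rw [starWinding_cons, ih fun d hd => h d (by simp [hd]), h ⟨(x, y), hadj⟩ (by simp)]
    ring

end Basic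

/-! ### Moving the base point -/

/-- Moving the base point one step to the right does not change the step winding of a step
avoiding the new base point. [folklore] -/
theorem starStepWinding_right {u x y : Site 2} (hx : x ≠ u + Pi.single 0 1) (hy : y ≠ u + Pi.single 0 1) :
    starStepWinding u x y = starStepWinding (u + Pi.single 0 1) x y := by
  have hx' : ¬(x 0 = u 0 + 1 ∧ x 1 = u 1) := by
    rintro ⟨h0, h1⟩; apply hx; ext i; fin_cases i <;> simp [h0, h1]
  have hy' : ¬(y 0 = u 0 + 1 ∧ y 1 = u 1) := by
    rintro ⟨h0, h1⟩; apply hy; ext i; fin_cases i <;> simp [h0, h1]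
  unfold starStepWinding starUpStep
  simp only [Pi.add_apply, Pi.single_eq_same, Pi.single_eq_of_ne (show (1 : Fin 2) ≠ 0 by decide), add_zero]
  split_ifs <;> omega

/-- Moving the base point one step up changes the step winding of a `∗`-step avoiding `u` and
`u + e₁` by minus the flow out of the half-line `rayAbove u`. [folklore] -/
theorem starStepWinding_up {u x y : Site 2} (hadj : zdStarGraph.Adj x y) (hxu : x ≠ u) (hyu : y ≠ u)
    (hx : x ≠ u + Pi.single 1 1) (hy : y ≠ u + Pi.single 1 1) [DecidablePred (· ∈ rayAbove u)] :
    starStepWinding u x y - starStepWinding (u + Pi.single 1 1) x y = -flowOut (rayAbove u) x y := by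
  rw [zdStarGraph_adj] at hadj
  obtain ⟨hne, hclose⟩ := hadj
  have h0 := hclose 0; have h1 := hclose 1
  rw [abs_le] at h0 h1
  have hxu' : ¬(x 0 = u 0 ∧ x 1 = u 1) := by
    rintro ⟨e0, e1⟩; apply hxu; ext i; fin_cases i <;> simp [e0, e1]
  have hyu' : ¬(y 0 = u 0 ∧ y 1 = u 1) := by
    rintro ⟨e0, e1⟩; apply hyu; ext i; fin_cases i <;> simp [e0, e1]
  have hx' : ¬(x 0 = u 0 ∧ x 1 = u 1 + 1) := by
    rintro ⟨e0, e1⟩; apply hx; ext i; fin_cases i <;> simp [e0, e1]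
  have hy' : ¬(y 0 = u 0 ∧ y 1 = u 1 + 1) := by
    rintro ⟨e0, e1⟩; apply hy; ext i; fin_cases i <;> simp [e0, e1]
  have hne' : ¬(x 0 = y 0 ∧ x 1 = y 1) := by
    rintro ⟨e0, e1⟩; apply hne; ext i; fin_cases i <;> simp [e0, e1]
  unfold starStepWinding starUpStep flowOut
  simp only [Pi.add_apply, Pi.single_eq_same, Pi.single_eq_of_ne (show (0 : Fin 2) ≠ 1 by decide), add_zero,
    mem_rayAbove]
  split_ifs <;> omega

/-- `Σ f - Σ g = Σ (f - g)` over a list. [folklore] -/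
theorem list_sum_map_sub {α : Type*} (l : List α) (f g : α → ℤ) :
    (l.map f).sum - (l.map g).sum = (l.map fun x => f x - g x).sum := by
  induction l with
  | nil => simp
  | cons x l ih => simp only [List.map_cons, List.sum_cons, ← ih]; ring

/-- **Constancy of the winding number along lattice walks avoiding the `∗`-walk** (Kesten 1982,
§2.2): if the lattice walk `q` avoids the vertices of the `∗`-walk `p`, and the endpoints of `p`
are together on or off each half-line swept (`rayAbove z` for the lower end `z` of each vertical
step of `q`; automatic for closed `p`), then `p` winds equally around both ends of `q`. [cite: Kesten1982, §2.2] -/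
theorem starWinding_eq_of_latticeWalk {a b : Site 2} (p : zdStarGraph.Walk a b) {c d : Site 2}
    (q : (zdGraph 2).Walk c d) (hq : ∀ z ∈ q.support, z ∉ p.support)
    (hab : ∀ z ∈ q.support, ∀ z' ∈ q.support, z' = z + Pi.single 1 1 → (a ∈ rayAbove z ↔ b ∈ rayAbove z)) :
    starWinding p c = starWinding p d := by
  classical
  -- one step right / up
  have hright : ∀ u, u ∉ p.support → u + Pi.single 0 1 ∉ p.support →
      starWinding p u = starWinding p (u + Pi.single 0 1) := by
    intro u _ hu'
    unfold starWinding
    congr 1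
    refine List.map_congr_left fun dd hdd => ?_
    have h1 := Walk.dart_fst_mem_support_of_mem_darts p hdd
    have h2 := Walk.dart_snd_mem_support_of_mem_darts p hdd
    exact starStepWinding_right (fun h => hu' (by rwa [h] at h1)) (fun h => hu' (by rwa [h] at h2))
  have hup : ∀ u, u ∉ p.support → u + Pi.single 1 1 ∉ p.support → (a ∈ rayAbove u ↔ b ∈ rayAbove u) →
      starWinding p u = starWinding p (u + Pi.single 1 1) := by
    intro u hu hu' hiff
    have hsum : starWinding p u - starWinding p (u + Pi.single 1 1) =
        (p.darts.map fun dd => -flowOut (rayAbove u) dd.fst dd.snd).sum := by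
      unfold starWinding
      rw [list_sum_map_sub]
      congr 1
      refine List.map_congr_left fun dd hdd => ?_
      have h1 := Walk.dart_fst_mem_support_of_mem_darts p hdd
      have h2 := Walk.dart_snd_mem_support_of_mem_darts p hdd
      exact starStepWinding_up dd.adj (fun h => hu (by rwa [h] at h1)) (fun h => hu (by rwa [h] at h2))
        (fun h => hu' (by rwa [h] at h1)) (fun h => hu' (by rwa [h] at h2))
    have hneg : ∀ (l : List zdStarGraph.Dart), (l.map fun dd => -flowOut (rayAbove u) dd.fst dd.snd).sum =
        -(l.map fun dd => flowOut (rayAbove u) dd.fst dd.snd).sum := by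
      intro l; induction l with
      | nil => simp
      | cons x l ih => simp only [List.map_cons, List.sum_cons, ih]; ring
    rw [hneg p.darts, sum_flowOut] at hsum
    have h0 : ((if a ∈ rayAbove u then (1:ℤ) else 0) - if b ∈ rayAbove u then 1 else 0) = 0 := by
      by_cases ha : a ∈ rayAbove u
      · rw [if_pos ha, if_pos (hiff.1 ha)]; ring
      · rw [if_neg ha, if_neg (fun h => ha (hiff.2 h))]; ring
    rw [h0, neg_zero, sub_eq_zero] at hsum
    exact hsum
  induction q with
  | nil => rfl
  | cons h q ih =>
    rename_i x y z
    have hx : x ∈ (Walk.cons h q).support := by simp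
    have hy : y ∈ (Walk.cons h q).support := by simp
    have htail : ∀ w ∈ q.support, w ∈ (Walk.cons h q).support := fun w hw => by simp [hw]
    have step : starWinding p x = starWinding p y := by
      rcases stepKind_of_adj h with ⟨h0, h1⟩ | ⟨h0, h1⟩ | ⟨h1, h0⟩ | ⟨h1, h0⟩
      · have hyeq : y = x + Pi.single 0 1 := by
          ext i; fin_cases i <;> simp [h0, h1]
        rw [hyeq]; exact hright x (hq x hx) (hyeq ▸ hq y hy)
      · have hxeq : x = y + Pi.single 0 1 := by
          ext i; fin_cases i <;> simp [h0, h1]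
        rw [hxeq]; exact (hright y (hq y hy) (hxeq ▸ hq x hx)).symm
      · have hyeq : y = x + Pi.single 1 1 := by
          ext i; fin_cases i <;> simp [h0, h1]
        have hiff := hab x hx y hy hyeq
        rw [hyeq]; exact hup x (hq x hx) (hyeq ▸ hq y hy) hiff
      · have hxeq : x = y + Pi.single 1 1 := by
          ext i; fin_cases i <;> simp [h0, h1]
        have hiff := hab y hy x hx hxeq
        rw [hxeq]; exact (hup y (hq y hy) (hxeq ▸ hq x hx) hiff).symm
    rw [step]
    exact ih (fun w hw => hq w (htail w hw)) (fun w hw w' hw' => hab w (htail w hw) w' (htail w' hw'))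

/-! ### Vanishing far away -/

section Far

variable {a b : Site 2}

/-- No winding at or above the top of the walk. [folklore] -/
theorem starWinding_eq_zero_of_le (p : zdStarGraph.Walk a b) {u : Site 2} {N : ℤ}
    (hp : ∀ z ∈ p.support, z 1 ≤ N) (hu : N ≤ u 1) : starWinding p u = 0 := by
  induction p with
  | nil => rfl
  | cons h p ih =>
    rename_i x y z
    rw [starWinding_cons, ih fun w hw => hp w (by simp [hw]), add_zero]
    have hx := hp x (by simp); have hy := hp y (by simp)
    unfold starStepWinding starUpStep; split_ifs <;> omega

/-- No winding strictly below the bottom of the walk. [folklore] -/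
theorem starWinding_eq_zero_of_ge (p : zdStarGraph.Walk a b) {u : Site 2} {L : ℤ}
    (hp : ∀ z ∈ p.support, L ≤ z 1) (hu : u 1 + 1 ≤ L) : starWinding p u = 0 := by
  induction p with
  | nil => rfl
  | cons h p ih =>
    rename_i x y z
    rw [starWinding_cons, ih fun w hw => hp w (by simp [hw]), add_zero]
    have hx := hp x (by simp); have hy := hp y (by simp)
    unfold starStepWinding starUpStep; split_ifs <;> omega

/-- No winding to the right of the walk. [folklore] -/
theorem starWinding_eq_zero_of_col_le (p : zdStarGraph.Walk a b) {u : Site 2} {R : ℤ}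
    (hp : ∀ z ∈ p.support, z 0 ≤ R) (hu : R ≤ u 0) : starWinding p u = 0 := by
  induction p with
  | nil => rfl
  | cons h p ih =>
    rename_i x y z
    rw [starWinding_cons, ih fun w hw => hp w (by simp [hw]), add_zero]
    have hx := hp x (by simp); have hy := hp y (by simp)
    unfold starStepWinding starUpStep; split_ifs <;> omega

/-- A closed `∗`-walk does not wind around points to its left (net crossings of a full
horizontal line vanish). [folklore] -/
theorem starWinding_eq_zero_of_le_col (p : zdStarGraph.Walk a a) {u : Site 2} {L : ℤ}
    (hp : ∀ z ∈ p.support, L ≤ z 0) (hu : u 0 + 1 ≤ L) : starWinding p u = 0 := by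
  have h := starWinding_eq_of_telescope p u (fun z => if u 1 + 1 ≤ z 1 then 1 else 0) fun d hd => ?_
  · rw [h]; ring
  · have hx := hp d.fst (Walk.dart_fst_mem_support_of_mem_darts p hd)
    have hy := hp d.snd (Walk.dart_snd_mem_support_of_mem_darts p hd)
    have hadj := d.adj
    rw [zdStarGraph_adj] at hadj
    have h1 := hadj.2 1
    rw [abs_le] at h1
    unfold starStepWinding starUpStep
    split_ifs <;> omega

/-- **A closed `∗`-walk inside the box `Λ_H` does not wind around points outside `Λ_H`.** [folklore] -/
theorem starWinding_eq_zero_of_not_mem_box (p : zdStarGraph.Walk a a) {H : ℕ} (hp : ∀ z ∈ p.support, z ∈ box 2 H)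
    {u : Site 2} (hu : u ∉ box 2 H) : starWinding p u = 0 := by
  have hpz : ∀ z ∈ p.support, ∀ j, -(H : ℤ) ≤ z j ∧ z j ≤ H := fun z hz => mem_box.1 (hp z hz)
  obtain ⟨i, hi⟩ : ∃ i, u i < -(H : ℤ) ∨ (H : ℤ) < u i := by
    by_contra h
    push Not at h
    exact hu (mem_box.2 fun i => ⟨(h i).1, (h i).2⟩)
  fin_cases i
  · rcases hi with h | h
    · exact starWinding_eq_zero_of_le_col p (L := -H) (fun z hz => (hpz z hz 0).1) (by change u 0 < -(H:ℤ) at h; omega)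
    · exact starWinding_eq_zero_of_col_le p (R := H) (fun z hz => (hpz z hz 0).2) (by change (H:ℤ) < u 0 at h; omega)
  · rcases hi with h | h
    · exact starWinding_eq_zero_of_ge p (L := -H) (fun z hz => (hpz z hz 1).1) (by change u 1 < -(H:ℤ) at h; omega)
    · exact starWinding_eq_zero_of_le p (N := H) (fun z hz => (hpz z hz 1).2) (by change (H:ℤ) < u 1 at h; omega)

end Far

/-! ### The eye lemma -/

section Eye

/-- End point of a vertical run down. [folklore] -/
theorem iterate_sub_single_one (z : Site 2) (k : ℕ) :
    (fun w : Site 2 => w - Pi.single 1 1)^[k] z = z - (k : ℤ) • Pi.single 1 1 := by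
  induction k with
  | zero => simp
  | succ k ih =>
    rw [Function.iterate_succ_apply', ih]
    ext i; fin_cases i
    · simp
    · simp; ring

/-- Winding of an upper semicircuit around a window point on the axis: `-1`. [folklore] -/
theorem starWinding_upper_axis {aL bR c₁ c₂ : ℤ} {m : ℕ} (hac : aL < c₁) (hcb : c₂ < bR)
    {xL xR : Site 2} (hxL0 : xL 0 = aL) (hxR0 : xR 0 = bR) (hxR1 : xR 1 = 0)
    (α : zdStarGraph.Walk xL xR) (hα : ∀ z ∈ α.support, 0 ≤ z 1 ∧ ¬ (c₁ ≤ z 0 ∧ z 0 ≤ c₂ ∧ z 1 ≤ m))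
    {u₀ : Site 2} (hu : c₁ ≤ u₀ 0 ∧ u₀ 0 ≤ c₂) (hu1 : u₀ 1 = 0) : starWinding α u₀ = -1 := by
  have hu₀ : u₀ ∉ α.support := fun h => (hα u₀ h).2 ⟨hu.1, hu.2, by rw [hu1]; positivity⟩
  rw [starWinding_eq_of_telescope α u₀ (fun z => if z 1 = 0 ∧ u₀ 0 + 1 ≤ z 0 then -1 else 0)]
  · rw [if_pos ⟨hxR1, by omega⟩, if_neg (by omega)]; ring
  · intro d hd
    have hx := hα d.fst (Walk.dart_fst_mem_support_of_mem_darts α hd)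
    have hy := hα d.snd (Walk.dart_snd_mem_support_of_mem_darts α hd)
    have hxu : ¬(d.fst 0 = u₀ 0 ∧ d.fst 1 = 0) := by
      rintro ⟨e0, e1⟩; apply hu₀
      have : d.fst = u₀ := by ext i; fin_cases i <;> simp [e0, e1, hu1]
      rw [← this]; exact Walk.dart_fst_mem_support_of_mem_darts α hd
    have hyu : ¬(d.snd 0 = u₀ 0 ∧ d.snd 1 = 0) := by
      rintro ⟨e0, e1⟩; apply hu₀
      have : d.snd = u₀ := by ext i; fin_cases i <;> simp [e0, e1, hu1]
      rw [← this]; exact Walk.dart_snd_mem_support_of_mem_darts α hd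
    have hadj := d.adj
    rw [zdStarGraph_adj] at hadj
    have h0 := hadj.2 0; have h1 := hadj.2 1
    rw [abs_le] at h0 h1
    unfold starStepWinding starUpStep
    split_ifs <;> omega

/-- Winding of a lower semicircuit around a window point just below the axis: `+1`. [folklore] -/
theorem starWinding_lower_below_axis {aL bR c₁ c₂ : ℤ} {m : ℕ} (hac : aL < c₁) (hcb : c₂ < bR)
    {xL xR : Site 2} (hxL0 : xL 0 = aL) (hxR0 : xR 0 = bR) (hxR1 : xR 1 = 0)
    (α' : zdStarGraph.Walk xL xR) (hα' : ∀ z ∈ α'.support, z 1 ≤ 0 ∧ ¬ (c₁ ≤ z 0 ∧ z 0 ≤ c₂ ∧ -(m : ℤ) ≤ z 1))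
    (hm : 1 ≤ m) {u₁ : Site 2} (hu : c₁ ≤ u₁ 0 ∧ u₁ 0 ≤ c₂) (hu1 : u₁ 1 = -1) : starWinding α' u₁ = 1 := by
  have hu₁ : u₁ ∉ α'.support := fun h => (hα' u₁ h).2 ⟨hu.1, hu.2, by rw [hu1]; omega⟩
  have hu₀ : ∀ z ∈ α'.support, ¬(z 0 = u₁ 0 ∧ z 1 = 0) := fun z hz ⟨e0, e1⟩ =>
    (hα' z hz).2 ⟨by rw [e0]; exact hu.1, by rw [e0]; exact hu.2, by rw [e1]; omega⟩
  rw [starWinding_eq_of_telescope α' u₁ (fun z => if z 1 = 0 ∧ u₁ 0 + 1 ≤ z 0 then 1 else 0)]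
  · rw [if_pos ⟨hxR1, by omega⟩, if_neg (by omega)]; ring
  · intro d hd
    have hx := hα' d.fst (Walk.dart_fst_mem_support_of_mem_darts α' hd)
    have hy := hα' d.snd (Walk.dart_snd_mem_support_of_mem_darts α' hd)
    have hx0 := hu₀ d.fst (Walk.dart_fst_mem_support_of_mem_darts α' hd)
    have hy0 := hu₀ d.snd (Walk.dart_snd_mem_support_of_mem_darts α' hd)
    have hxu : ¬(d.fst 0 = u₁ 0 ∧ d.fst 1 = -1) := by
      rintro ⟨e0, e1⟩; apply hu₁
      have : d.fst = u₁ := by ext i; fin_cases i <;> simp [e0, e1, hu1]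
      rw [← this]; exact Walk.dart_fst_mem_support_of_mem_darts α' hd
    have hyu : ¬(d.snd 0 = u₁ 0 ∧ d.snd 1 = -1) := by
      rintro ⟨e0, e1⟩; apply hu₁
      have : d.snd = u₁ := by ext i; fin_cases i <;> simp [e0, e1, hu1]
      rw [← this]; exact Walk.dart_snd_mem_support_of_mem_darts α' hd
    have hadj := d.adj
    rw [zdStarGraph_adj] at hadj
    have h0 := hadj.2 0; have h1 := hadj.2 1
    rw [abs_le] at h0 h1
    unfold starStepWinding starUpStep
    split_ifs <;> omega

/-- **The eye lemma** (discrete Jordan curve theorem for a pair of semicircuits): if `α` is a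
`∗`-walk in the closed upper half-plane and `α'` one in the closed lower half-plane, both from
`(a, 0)` to `(b, 0)` and both avoiding the window `D = [c₁, c₂] × [-m, m]`, `a < c₁ ≤ c₂ < b`,
then every lattice walk from a site of `D` to a site outside a box `Λ_H ⊇ α ∪ α'` meets `α` or
`α'` (Georgii–Higuchi 2000 use this in the proofs of Lemma 5.2 — "`x` is surrounded by a
`+∗`semicircuit" — and Lemma 5.5 — "`Δ` is surrounded by a `≤∗`circuit"). [cite: GeorgiiHiguchi2000, Lemma 5.2 and Lemma 5.5 (proofs)] -/
theorem exists_mem_support_of_semicircuits {aL bR c₁ c₂ : ℤ} {m : ℕ} (hac : aL < c₁) (hcb : c₂ < bR)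
    {xL xR : Site 2} (hxL0 : xL 0 = aL) (hxL1 : xL 1 = 0) (hxR0 : xR 0 = bR) (hxR1 : xR 1 = 0)
    (α : zdStarGraph.Walk xL xR) (hα : ∀ z ∈ α.support, 0 ≤ z 1 ∧ ¬ (c₁ ≤ z 0 ∧ z 0 ≤ c₂ ∧ z 1 ≤ m))
    (α' : zdStarGraph.Walk xL xR) (hα' : ∀ z ∈ α'.support, z 1 ≤ 0 ∧ ¬ (c₁ ≤ z 0 ∧ z 0 ≤ c₂ ∧ -(m : ℤ) ≤ z 1))
    {H : ℕ} (hH : ∀ z ∈ α.support, z ∈ box 2 H) (hH' : ∀ z ∈ α'.support, z ∈ box 2 H)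
    {u w : Site 2} (hu : c₁ ≤ u 0 ∧ u 0 ≤ c₂ ∧ -(m : ℤ) ≤ u 1 ∧ u 1 ≤ m) (hw : w ∉ box 2 H)
    (β : (zdGraph 2).Walk u w) : ∃ z ∈ β.support, z ∈ α.support ∨ z ∈ α'.support := by
  by_contra hdis
  push Not at hdis
  set C := α.append α'.reverse with hC
  have hCsupp : ∀ z, z ∈ C.support ↔ z ∈ α.support ∨ z ∈ α'.support := fun z => by
    rw [hC, Walk.mem_support_append_iff, Walk.support_reverse, List.mem_reverse]
  -- the winding of `C` vanishes at `w` and is constant along `β`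
  have hw0 : starWinding C w = 0 :=
    starWinding_eq_zero_of_not_mem_box C (fun z hz => by
      rcases (hCsupp z).1 hz with h | h
      · exact hH z h
      · exact hH' z h) hw
  have hconst : starWinding C u = starWinding C w :=
    starWinding_eq_of_latticeWalk C β (fun z hz h => by
      rcases (hCsupp z).1 h with h' | h'
      · exact (hdis z hz).1 h'
      · exact (hdis z hz).2 h') (fun _ _ _ _ _ => Iff.rfl)
  -- the winding of `C` at `u` is `-1`
  have hCu : starWinding C u = -1 := by
    rw [hC, starWinding_append, starWinding_reverse]
    rcases le_or_gt 0 (u 1) with hu0 | hu0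
    · -- `u` on or above the axis: move down to the axis
      obtain ⟨k, hk⟩ : ∃ k : ℕ, u 1 = k := ⟨(u 1).toNat, by omega⟩
      set u₀ := (fun w : Site 2 => w - Pi.single 1 1)^[k] u with hu₀def
      have hu₀ : u₀ = u - (k : ℤ) • Pi.single 1 1 := iterate_sub_single_one u k
      have hu₀0 : u₀ 0 = u 0 := by rw [hu₀]; simp
      have hu₀1 : u₀ 1 = 0 := by rw [hu₀]; simp; omega
      have hmove : starWinding α u = starWinding α u₀ := by
        refine starWinding_eq_of_latticeWalk α (downRun u k) (fun z hz hzα => ?_) (fun z hz z' hz' hzz' => ?_)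
        · rw [mem_support_downRun] at hz
          obtain ⟨hz0, hz1, hz2⟩ := hz
          exact (hα z hzα).2 ⟨by rw [hz0]; exact hu.1, by rw [hz0]; exact hu.2.1, by omega⟩
        · rw [mem_support_downRun] at hz hz'
          obtain ⟨hz0, hz1, hz2⟩ := hz
          obtain ⟨hz'0, hz'1, hz'2⟩ := hz'
          have : z' 1 = z 1 + 1 := by rw [hzz']; simp
          simp only [mem_rayAbove, hxL1, hxR1]
          constructor <;> rintro ⟨h1, -⟩ <;> omega
      have hα0 : starWinding α u₀ = -1 :=
        starWinding_upper_axis hac hcb hxL0 hxR0 hxR1 α hα ⟨by rw [hu₀0]; exact hu.1, by rw [hu₀0]; exact hu.2.1⟩ hu₀1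
      have hα'0 : starWinding α' u = 0 :=
        starWinding_eq_zero_of_le α' (N := 0) (fun z hz => (hα' z hz).1) hu0
      rw [hmove, hα0, hα'0]; ring
    · -- `u` below the axis: move up to the row `-1`
      have hm : 1 ≤ m := by
        have := hu.2.2.1; omega
      obtain ⟨k, hk⟩ : ∃ k : ℕ, u 1 = -1 - k := ⟨(-1 - u 1).toNat, by omega⟩
      -- `u₁ := (u 0, -1)`, and `u = u₁ - k e₁`
      set u₁ : Site 2 := u + (k : ℤ) • Pi.single 1 1 with hu₁def
      have hu₁0 : u₁ 0 = u 0 := by simp [hu₁def]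
      have hu₁1 : u₁ 1 = -1 := by simp [hu₁def]; omega
      have hend : (fun w : Site 2 => w - Pi.single 1 1)^[k] u₁ = u := by
        rw [iterate_sub_single_one]; simp [hu₁def]
      have hmove : starWinding α' u₁ = starWinding α' u := by
        have h := starWinding_eq_of_latticeWalk α' (downRun u₁ k) (fun z hz hzα => ?_) (fun z hz z' hz' hzz' => ?_)
        · rwa [hend] at h
        · rw [mem_support_downRun] at hz
          obtain ⟨hz0, hz1, hz2⟩ := hz
          exact (hα' z hzα).2 ⟨by rw [hz0, hu₁0]; exact hu.1, by rw [hz0, hu₁0]; exact hu.2.1, by omega⟩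
        · rw [mem_support_downRun] at hz hz'
          obtain ⟨hz0, hz1, hz2⟩ := hz
          obtain ⟨hz'0, hz'1, hz'2⟩ := hz'
          have : z' 1 = z 1 + 1 := by rw [hzz']; simp
          simp only [mem_rayAbove, hxL1, hxR1]
          constructor <;> rintro ⟨h1, -⟩ <;> omega
      have hα'1 : starWinding α' u₁ = 1 :=
        starWinding_lower_below_axis hac hcb hxL0 hxR0 hxR1 α' hα' hm
          ⟨by rw [hu₁0]; exact hu.1, by rw [hu₁0]; exact hu.2.1⟩ hu₁1
      have hα0 : starWinding α u = 0 :=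
        starWinding_eq_zero_of_ge α (L := 0) (fun z hz => (hα z hz).1) (by omega)
      rw [← hmove, hα'1, hα0]; ring
  rw [hCu, hw0] at hconst
  exact absurd hconst (by norm_num)

end Eye

end Literature.Probability.Percolation
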